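import Literature.NumberTheory.EllipticCurves.CPMuDescentGlobal
import Literature.NumberTheory.EllipticCurves.MuThreeTorsorImage
import Literature.NumberTheory.EllipticCurves.Curve6137ThreeDescentBox
import Literature.NumberTheory.EllipticCurves.MordellCurveCubicDescentLocal
import Literature.NumberTheory.GaloisRepresentations.HeckeCharacterProofs
import Mathlib.NumberTheory.Padics.HeightOneSpectrum
import HarnessLib

/-!
# The carrier `y² − 21xy + 6137y = x³`: the `φ̂`-Selmer group is filled by rational points, so
# `Ш(Ê/ℚ) ∩ ker φ̂_* = 0` (Cohen–Pazuki 2009, Thm. 2.1 / Prop. 2.2 with the local conditions of §1)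

Topic `NumberTheory/EllipticCurves`. The cross-prime carrier of route ShaPrimaryTransfer,
`E : y² − 21xy + 6137y = x³ = threeTorsionModel (−21/2) (6137/2)` (rank `2`, `t_2 = 0`:
`Curve6137TwoIsogenyDescent`), carries the rational `3`-isogeny `φ : E → Ê` with kernel
`⟨(0, 6137/2)⟩ ≅ ℤ/3`. Cohen–Pazuki's model of `Ê` is the `μ₃`-curve

  `V = cpCurve (−21/2) 9720 : y² = x³ − 3(−(21/2)x + 9720)²` (`b̂ = 3s − 4m³/9 = 9720`),

whose `3`-isogeny with kernel `⟨T̂⟩ = ⟨(0, 9720√−3)⟩ ≅ μ₃` lands — with the scaling `t = 3` of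
`CPMuDescentCurve.variableChange_codomain` — EXACTLY on `E = threeTorsionModel (−21/2) (6137/2)`
(`3·(−21/2) = 3a`, `27·(6137/2) = 4a³ + 9b̂`), with descent map `α = (x, y) ↦ y − (mx + s)`
(`ThreeTorsionDescent.descent`). This file proves that the `α`-Selmer side of the descent is SHARP:

* `three_dvd_padicValRat_of_torsorClass_mem_sha` — if `[C_u] ∈ Ш(V/ℚ)` then `3 ∣ v_p(u)` for every
  prime `p ∉ {17, 19}`: local necessity (`CPMuDescentLocal`) at the completion `ℚ_v`, the valuation of
  descent values (`three_dvd_log_threeTorsionDescent`, `2s = 6137 = 17·19²` a `p`-unit) and the bridge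
  `ℚ_v ↔ v_p` (`valuation_eq_exp_neg_padicValRat'`).
* `cubeClass_mem_closure_of_torsorClass_mem_sha` — hence `[u] ∈ {[17^i 19^j]}`
  (`cubeClass_eq_prod_of_support`), a subgroup generated by the descent classes `[α(P₁)] = [17]`,
  `[α(T)] = [17²·19]` of the rational points `P₁ = (−357, 986)`, `T = (0, 6137/2)`
  (`Curve6137ThreeDescentBox`): the Selmer group is filled by rational points.
* **`eq_zero_of_mem_sha_of_galH1Map_eq_zero`** — consequently, for EVERY `Γ_ℚ`-equivariant surjection
  `f : V(ℚ̄) → W'(ℚ̄)` with kernel in `{O, ±T̂}` (the `3`-isogeny `V → E`, the dual `φ̂` of `φ`, …):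
  `Ш(V/ℚ) ∩ ker f_* = 0` — the tree's form of **`Ш(Ê/ℚ)[φ̂] = 0`** for the carrier
  (`MuThreeTorsorImage` + `CPMuDescentGlobal`).

What is NOT here: the `φ`-side (`Ш(E/ℚ)[φ] = 0`, which needs the `ℤ/3`-kernel descent over `ℚ(ζ₃)`)
and the conclusion `Ш(E/ℚ)[3] = 0`.

## References

* [CohenPazuki2009] H. Cohen, F. Pazuki, Acta Arith. 140 (2009): §1 (Def. 1.3, Prop. 1.4), Thm. 2.1,
  Prop. 2.2.
* [SilvermanAEC2009] J. H. Silverman, *AEC*, Thm. X.4.2 and Prop. X.4.9.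
* Tree: `CPMuDescentCurve/Local/Global`, `MuThreeTorsorImage`, `Curve6137ThreeDescentBox`,
  `CubeClassRatSupport`.
-/

noncomputable section

open scoped Classical

open WeierstrassCurve IsDedekindDomain IsDedekindDomain.HeightOneSpectrum NumberField

namespace Literature.NumberTheory.EllipticCurves

namespace Carrier6137

open MordellDescent ThreeTorsionDescent CPMuDescent MuThreeKernel WithZero

/-! ## The data of Cohen–Pazuki's pair for the carrier -/

/-- `b̂ = 9720 ≠ 0`. [cite: CohenPazuki2009, Definition 1.3] -/
theorem hb' : (9720 : ℚ) ≠ 0 := by norm_num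

/-- `4a³ + 9b̂ = 165699/2 ≠ 0` (`a = −21/2`, `b̂ = 9720`). [cite: CohenPazuki2009, Definition 1.3] -/
theorem hd' : 4 * (-21 / 2 : ℚ) ^ 3 + 9 * 9720 ≠ 0 := by norm_num

/-- `t = 3`: `3 · (−21/2) = 3a`. [cite: CohenPazuki2009, Definition 1.3] -/
theorem hm₂' : (3 : ℚ) * (-21 / 2) = 3 * (-21 / 2) := rfl

/-- `t = 3`: `27 · (6137/2) = 4a³ + 9b̂`, i.e. the scaled codomain of the `μ₃`-isogeny of
`V = cpCurve (−21/2) 9720` is `E = threeTorsionModel (−21/2) (6137/2)` itself. [cite: CohenPazuki2009, Definition 1.3] -/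
theorem hs₂' : (3 : ℚ) ^ 3 * (6137 / 2) = 4 * (-21 / 2) ^ 3 + 9 * 9720 := by norm_num

/-- **Cohen–Pazuki's model of `Ê` is the translate of Vélu's quotient**:
`cpCurve (−21/2) 9720 = ⟨1, −147, 0, 0⟩ • threeIsogenyCodomain (−21/2) (6137/2)` (`−147 = −4m²/3`).
[cite: CohenPazuki2009, Definition 1.3] -/
theorem cpCurve_eq_variableChange_threeIsogenyCodomain :
    cpCurve (-21 / 2 : ℚ) 9720 =
      (⟨1, -147, 0, 0⟩ : VariableChange ℚ) • threeIsogenyCodomain (-21 / 2 : ℚ) (6137 / 2) := by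
  ext <;> simp [cpCurve, threeIsogenyCodomain, variableChange_a₁, variableChange_a₂, variableChange_a₃,
    variableChange_a₄, variableChange_a₆] <;> norm_num

/-! ## The bridge `ℚ_v ↔ v_p` -/

/-- **The `v`-adic valuation of `ℚ` is the `p`-adic one**: `v(x) = exp(−ord_p x)`, `p = natGenerator v`
(Mathlib: the two are equivalent, `valuation_equiv_padicValuation`; both send `p` to `exp(−1)`).
[folklore] -/
private theorem valuation_eq_exp_neg_padicValRat' (v : HeightOneSpectrum (𝓞 ℚ)) {x : ℚ} (hx : x ≠ 0) :
    v.valuation ℚ x = exp (-padicValRat (Rat.HeightOneSpectrum.natGenerator v) x) := by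
  haveI hp : Fact (Rat.HeightOneSpectrum.natGenerator v).Prime := ⟨Rat.HeightOneSpectrum.prime_natGenerator v⟩
  haveI hp' : Fact (Nat.Prime ((Rat.HeightOneSpectrum.primesEquiv v : Nat.Primes) : ℕ)) :=
    ⟨(Rat.HeightOneSpectrum.primesEquiv v).2⟩
  have hequiv := Rat.HeightOneSpectrum.valuation_equiv_padicValuation v
  set n : ℤ := padicValRat (Rat.HeightOneSpectrum.natGenerator v) x with hn
  have h2x : Rat.padicValuation (Rat.HeightOneSpectrum.primesEquiv v) x = exp (-n) := by
    change Rat.padicValuation (Rat.HeightOneSpectrum.natGenerator v) x = _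
    simp [Rat.padicValuation, hx, hn]
  have h2p : Rat.padicValuation (Rat.HeightOneSpectrum.primesEquiv v)
      ((Rat.HeightOneSpectrum.natGenerator v : ℚ) ^ n) = exp (-n) := by
    change Rat.padicValuation (Rat.HeightOneSpectrum.natGenerator v) _ = _
    rw [map_zpow₀, Rat.padicValuation_self, ← exp_zsmul]
    simp
  have h1p : v.valuation ℚ ((Rat.HeightOneSpectrum.natGenerator v : ℚ) ^ n) = exp (-n) := by
    rw [map_zpow₀, Literature.NumberTheory.GaloisRepresentations.Rat.valuation_natGenerator, ← exp_zsmul]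
    simp
  rw [← h1p]
  exact (hequiv.eq_iff).mpr (h2x.trans h2p.symm)

/-! ## Local necessity at the primes `p ∉ {17, 19}` -/

/-- Valuation bookkeeping over a `ℚ`-field `F` with a `ℤᵐ⁰`-valuation `V`: if `α(P)^e = φ(u) w³` for a
point `P` of `threeTorsionModel (φ m) (φ s)` with `V(φ(2s)) = 1`, `V(φ(2m)) ≤ 1`, then `3 ∣ log V(φ u)`.
[cite: CohenPazuki2009, Theorem 2.1 (2)] -/
theorem three_dvd_log_of_descent_pow_eq {F : Type*} [Field F] (V : Valuation F ℤᵐ⁰) (φ : ℚ →+* F)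
    {m s u : ℚ} (hs : V (φ (2 * s)) = 1) (hm : V (φ (2 * m)) ≤ 1) (hu : u ≠ 0)
    {P : (threeTorsionModel (φ m) (φ s)).toAffine.Point} {w : F} {e : ℕ} (hw : w ≠ 0)
    (hP : descent (threeTorsionModel (φ m) (φ s)) (φ m) (φ s) P ^ e = φ u * w ^ 3) :
    (3 : ℤ) ∣ WithZero.log (V (φ u)) := by
  have hvs : V (2 * φ s) = 1 := by rw [← map_ofNat φ 2, ← map_mul, hs]
  have hvm : V (2 * φ m) ≤ 1 := by rw [← map_ofNat φ 2, ← map_mul]; exact hm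
  have hδ := V.three_dvd_log_threeTorsionDescent rfl hvs hvm P
  have huF : φ u ≠ 0 := (map_ne_zero φ).mpr hu
  have key := congrArg (fun z => WithZero.log (V z)) hP
  rw [V.log_map_pow, V.log_map_mul huF (pow_ne_zero 3 hw), V.log_map_pow] at key
  obtain ⟨c, hc⟩ := hδ
  rw [hc] at key
  exact ⟨e * c - WithZero.log (V w), by linear_combination -key⟩

/-- **`[C_u] ∈ Ш(V/ℚ) ⟹ 3 ∣ v_p(u)` for every prime `p ∉ {17, 19}`.** At the completion `ℚ_v`
(`v ↔ p`), local necessity gives `α(P)^e = u w³` for a local point `P ∈ E(ℚ_v)`, and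
`3 ∣ ord_v α(P)` as `2s = 6137 = 17·19²` is a `p`-unit and `2m = −21 ∈ ℤ`
(Cohen–Pazuki Thm. 2.1 (2)–(3): «`u ∣ (2b)²`»). [cite: CohenPazuki2009, Theorem 2.1 (2)–(3)] -/
theorem three_dvd_padicValRat_of_torsorClass_mem_sha {u : ℚ} (hu : u ≠ 0)
    (hsha : (kernelDatum hb' hd').torsorClass hu ∈ (cpCurve (-21 / 2 : ℚ) 9720).sha)
    (p : ℕ) (hp : p.Prime) (h17 : p ≠ 17) (h19 : p ≠ 19) : (3 : ℤ) ∣ padicValRat p u := by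
  haveI : Fact p.Prime := ⟨hp⟩
  -- the place `v` over `p`
  set v : HeightOneSpectrum (𝓞 ℚ) := (Rat.HeightOneSpectrum.primesEquiv (R := 𝓞 ℚ)).symm ⟨p, hp⟩ with hv
  have hvp : Rat.HeightOneSpectrum.natGenerator v = p := by
    have : (Rat.HeightOneSpectrum.primesEquiv (R := 𝓞 ℚ) v : ℕ) = p := by
      rw [hv, Equiv.apply_symm_apply]
    exact this
  -- local necessity at `ℚ_v`
  obtain ⟨P, w, e, hw, hP⟩ :=
    exists_descent_pow_eq_adicCompletion_of_torsorClass_mem_sha hb' hd' (t := 3) (by norm_num) hm₂' hs₂' hu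
      hsha v
  -- valuations on `ℚ_v` restrict to `v` on `ℚ`, which is `exp(−ord_p)`
  set φ : ℚ →+* v.adicCompletion ℚ := @algebraMap ℚ (v.adicCompletion ℚ) _ _
    (IsDedekindDomain.HeightOneSpectrum.instAlgebraAdicCompletion (𝓞 ℚ) ℚ v) with hφ
  have hval : ∀ x : ℚ, Valued.v (φ x) = v.valuation ℚ x := fun x => valuedAdicCompletion_eq_valuation' v x
  have h6137 : padicValRat p ((6137 : ℕ) : ℚ) = 0 := by
    rw [padicValRat.of_nat, Nat.cast_eq_zero]
    refine padicValNat.eq_zero_of_not_dvd fun hdvd => ?_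
    have h' : p ∣ 17 * 19 ^ 2 := by simpa using hdvd
    rcases (Nat.Prime.dvd_mul hp).mp h' with h1 | h1
    · exact h17 ((Nat.prime_dvd_prime_iff_eq hp (by decide)).mp h1)
    · exact h19 ((Nat.prime_dvd_prime_iff_eq hp (by decide)).mp (hp.dvd_of_dvd_pow h1))
  have key := three_dvd_log_of_descent_pow_eq Valued.v φ ?_ ?_ hu hw hP
  · rw [hval, valuation_eq_exp_neg_padicValRat' v hu, hvp, WithZero.log_exp, dvd_neg] at key
    exact key
  · rw [hval, show (2 : ℚ) * (6137 / 2) = ((6137 : ℕ) : ℚ) by norm_num,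
      valuation_eq_exp_neg_padicValRat' v (by norm_num), hvp, h6137, neg_zero, exp_zero]
  · rw [hval, show (2 : ℚ) * (-21 / 2) = ((-21 : ℤ) : ℚ) by norm_num,
      valuation_eq_exp_neg_padicValRat' v (by norm_num), hvp, ← exp_zero, exp_le_exp, neg_nonpos,
      padicValRat.of_int]
    exact_mod_cast Nat.zero_le _

/-! ## The box and its generators -/

/-- **`[C_u] ∈ Ш(V/ℚ) ⟹ [u] ∈ ⟨[α(P)] : P ∈ E(ℚ)⟩`**: by local necessity `[u] = [17^i 19^j]`, and the
box `{[17^i 19^j]}` is generated by the descent classes `[α(P₁)] = [17]`, `[α(T)] = [17²·19]` of the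
rational points `P₁ = (−357, 986)`, `T = (0, 6137/2)` — the `α`-Selmer group of the carrier is filled
by rational points (Cohen–Pazuki Prop. 2.2: `|Im α| = 9`). [cite: CohenPazuki2009, Theorem 2.1 and Proposition 2.2] -/
theorem cubeClass_mem_closure_of_torsorClass_mem_sha {u : ℚ} (hu : u ≠ 0)
    (hsha : (kernelDatum hb' hd').torsorClass hu ∈ (cpCurve (-21 / 2 : ℚ) 9720).sha) :
    cubeClass u ∈ Subgroup.closure (Set.range fun P : (threeTorsionModel (-21 / 2 : ℚ) (6137 / 2)).toAffine.Point =>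
      descentClass (threeTorsionModel (-21 / 2 : ℚ) (6137 / 2)) (-21 / 2) (6137 / 2) P) := by
  set S := Subgroup.closure (Set.range fun P : (threeTorsionModel (-21 / 2 : ℚ) (6137 / 2)).toAffine.Point =>
      descentClass (threeTorsionModel (-21 / 2 : ℚ) (6137 / 2)) (-21 / 2) (6137 / 2) P) with hS
  -- the box
  have hprimes : ∀ p ∈ ({17, 19} : Finset ℕ), p.Prime := by
    intro p hp
    simp only [Finset.mem_insert, Finset.mem_singleton] at hp
    rcases hp with rfl | rfl <;> decide
  obtain ⟨e, he, hcl⟩ := cubeClass_eq_prod_of_support {17, 19} hprimes hu (fun p hp hpS => by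
    have h17 : p ≠ 17 := fun h => hpS (by simp [h])
    have h19 : p ≠ 19 := fun h => hpS (by simp [h])
    exact three_dvd_padicValRat_of_torsorClass_mem_sha hu hsha p hp h17 h19)
  rw [hcl, Finset.prod_pair (by norm_num)]
  push_cast
  -- the generators `[17]` and `[17²·19]` are descent classes, hence so is `[19]`
  have h17 : cubeClass (17 : ℚ) ∈ S := by
    rw [← descentClass_P₁]; exact Subgroup.subset_closure ⟨_, rfl⟩
  have h1719 : cubeClass ((17 : ℚ) ^ 2 * 19) ∈ S := by
    rw [← descentClass_T]; exact Subgroup.subset_closure ⟨_, rfl⟩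
  have h19 : cubeClass (19 : ℚ) ∈ S := by
    have e1 : cubeClass (19 : ℚ) = cubeClass ((17 : ℚ) ^ 2 * 19) * cubeClass (17 : ℚ) := by
      rw [← cubeClass_mul (by norm_num) (by norm_num),
        show ((17 : ℚ) ^ 2 * 19) * 17 = 19 * 17 ^ 3 by norm_num, cubeClass_mul_pow_three (by norm_num) (by norm_num)]
    rw [e1]; exact S.mul_mem h1719 h17
  rw [cubeClass_mul (pow_ne_zero _ (by norm_num)) (pow_ne_zero _ (by norm_num)),
    cubeClass_pow (by norm_num), cubeClass_pow (by norm_num)]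
  exact S.mul_mem (S.pow_mem h17 _) (S.pow_mem h19 _)
  where
  /-- `[a^n] = [a]^n`. -/
  cubeClass_pow {a : ℚ} (ha : a ≠ 0) (n : ℕ) : cubeClass (a ^ n) = cubeClass a ^ n := by
    induction n with
    | zero => rw [pow_zero, pow_zero, cubeClass_one]
    | succ n ih => rw [pow_succ, pow_succ, cubeClass_mul (pow_ne_zero _ ha) ha, ih]

/-! ## `Ш(V/ℚ) ∩ ker f_* = 0` -/

/-- **`Ш(Ê/ℚ)[φ̂] = 0` for the carrier**, in the tree's form: for every `Γ_ℚ`-equivariant homomorphism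
`f : V(ℚ̄) → W'(ℚ̄)` which is onto and whose kernel is contained in `{O, ±T̂}`
(`V = cpCurve (−21/2) 9720 ≅ Ê`, `T̂ = (0, 9720√−3)`; e.g. the `3`-isogeny `V → E` or the abstract
dual of `φ : E → Ê`), no non-zero class of `Ш(V/ℚ)` is killed by `f_*`. The `μ₃`-descent of the carrier
is complete on this side: the `α`-Selmer group is the `9`-element box filled by `E(ℚ)`
(Cohen–Pazuki Prop. 2.2, `b = 2`). [cite: CohenPazuki2009, Theorem 2.1 and Proposition 2.2]
[cite: SilvermanAEC2009, Thm. X.4.2 (a)] -/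
theorem eq_zero_of_mem_sha_of_galH1Map_eq_zero {W' : WeierstrassCurve ℚ}
    (f : geomPoints (cpCurve (-21 / 2 : ℚ) 9720) →+ geomPoints W')
    (hf : ∀ (σ : Field.absoluteGaloisGroup ℚ) (P : geomPoints (cpCurve (-21 / 2 : ℚ) 9720)),
      f (σ • P) = σ • f P)
    (hsurj : Function.Surjective f)
    (hker : ∀ P, f P = 0 → P = 0 ∨ P = (kernelDatum hb' hd').T ∨ P = -(kernelDatum hb' hd').T)
    {c : (cpCurve (-21 / 2 : ℚ) 9720).galH1} (hc : c ∈ (cpCurve (-21 / 2 : ℚ) 9720).sha)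
    (h0 : galH1Map f hf c = 0) : c = 0 :=
  (kernelDatum hb' hd').eq_zero_of_mem_sha_of_galH1Map_eq_zero_of_closure f hf hsurj hker
    (Set.range fun P : (threeTorsionModel (-21 / 2 : ℚ) (6137 / 2)).toAffine.Point =>
      descentClass (threeTorsionModel (-21 / 2 : ℚ) (6137 / 2)) (-21 / 2) (6137 / 2) P)
    (by
      rintro _ ⟨P, rfl⟩
      exact torsorClassQuotHom_descentClass hb' hd' (t := 3) (by norm_num) hm₂' hs₂' P)
    (fun u hu hsha => cubeClass_mem_closure_of_torsorClass_mem_sha hu hsha) hc h0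

end Carrier6137

end Literature.NumberTheory.EllipticCurves

end
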